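import Summits.QuantumFields.BalabanUV.Beta.FP.SliceProjectorBlochChart

/-!
# `BalabanUV.Beta.FP.SliceProjectorBloch` — road «FP» (binder row D1), organisation γ, row **GAMMA-3 (d)** part 2∕4: THE SYMBOL ALGEBRA OF
# `1 − Π` — gen-8's Bloch symbol `S` IS RANK ONE (`S = Ra·Rb∕𝒩` with the POLE-FREE row∕column alias sums `Ra`, `Rb`), the regrouped denominator is
# the trace of the numerator (`𝒩 = Σ_l U_l·e_l²`), hence **the alias matrix `Aent` is a PROJECTOR** (`Σ_m A_{lm}A_{ml′} = A_{ll′}` on the fat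
# strip), CHARACTER ORTHOGONALITY over the intra-block offsets, and the two **BLOCK READINGS OF `Q′`** (`Σ_l qb_l(k)e^{ik_l·x} = e^{ik·blk x}`,
# `Σ_l qa_l(k)e^{−ik_l·y} = e^{−ik·blk y}`: the block mean sees a fine point only through its block)

HONEST FRAMING (cell contract, verbatim): «discharging `BetaPertH` makes Bałaban's UV stability UNCONDITIONAL — a real constructive-QFT
result; it is NOT the continuum limit and NOT the Clay problem.»  HONEST DEPENDENCY (verbatim): «continuum YM on T⁴ ⇐ BetaPertH ∧ nine
spine estimates (0/9 proved); BetaPertH ⇐ (D1) ∧ (D4) ∧ CAP+tail; G-an2-4 gates asym, D1 and NE2/3/4.»  THIS MODULE DISCHARGES NOTHING of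
D1 ∕ BetaPertH: [folklore] finite-sum algebra over the objects of `FP/SliceProjectorEntries` ✓ p244695 (`qa`, `qb`, `ew`, `Aent`, `qa_mul_qb`),
`B5Strip145.Ncal`∕`Xne` (the audit's regrouping of B4 (1.45)) and `SliceProjectorBlochChart` ✓ (characters); [our object] data defs `Ra`, `Rb`;
no `def … : Prop`; nothing is cited; 0 sorry.  NOT summit progress; NOT hbook, NOT D1, NOT BetaPertH, NOT continuum, NOT Clay.

ABSOLUTE RULE (cell, verbatim): «No internally-minted statement may enter as a cited fact. Every hypothesis is either kernel-proved in this
package or a verbatim quotation of a PUBLISHED theorem with page reference. The manuscript(s) under audit are NOT citable for their own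
disputed steps — they are the thing under adjudication; programme-internal (2001/route/tribunal) claims are never citable.»

CONTENT (`D = d+1`, `N ≥ 1`; «fat strip» = `B4StripCauchy.Fat D (rOf D)` ⊇ `Strip D κ_Y` ⊇ the real Brillouin zone):
* `cphase_neg_left`; [our object] **`Ra`**, **`Rb`**; **`S_eq_Ra_mul_Rb`** (`S N a b k = Ra N a k·Rb N b k∕𝒩(k)`, no side condition);
  **`Ncal_eq_sum_U_mul_ew_sq`** (`𝒩 = Σ_l U_l e_l²`, everywhere); **`ew_mul_DeltaXi_shift`** (`e_l·Δ^ξ(k+2πl) = Δ^ξ(k)`: the pole cancels);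
  **`sum_Aent_mul_Aent`** (projector); **`sum_cphase_finSite`** (`Σ_c e^{−ik_l·c}e^{ik_{l′}·c} = N^D δ_{ll′}`); `qa_eq_sum_cphase`,
  `qb_eq_sum_cphase` (`qa`, `qb` as character sums over the offsets); `dvd_sub_finSite_iff`; **`sum_qb_mul_cphase`**, **`sum_qa_mul_cphase_neg`**.
Unit `b2b-balaban-beta-d1-formalise-leaf-06` (gen 9), road «FP» OWNER GO «THIS SHAPE» journal l.27277 (1) on INTENT l.27194; organisation γ (R-FP-25), row GAMMA-3 (d), under R-FP-33 (b)(c).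
-/

noncomputable section

namespace Summit.QuantumFields.BalabanUV.Beta.FP.SliceProjectorBloch

open Complex Finset MeasureTheory
open scoped BigOperators Real
open Literature.MathematicalPhysics.QuantumFieldTheory.Balaban1983to89
open B4Strip (Strip ofRealVec DeltaXi Delta1 shift U shift_zero)
open B4StripCauchy (Fat rOf rOf_le)
open B5Strip145 (Ncal Xne)
open Beta.FibreInverseDecay (cphase)
open Summit.QuantumFields.BalabanUV.Beta.GAN24.FibreSymbols (gsum pw pw_add)
open Summit.QuantumFields.BalabanUV.Beta.GAN24.AliasDecimate (aliasPt)
open Summit.QuantumFields.BalabanUV.Beta.FP.SliceProjectorEntries (qa qb ew Aent ew_zero ew_ne qa_mul_qb)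
open Summit.QuantumFields.BalabanUV.Beta.FP.SliceProjectorSymbol (S)
open Summit.QuantumFields.BalabanUV.Beta.FP.SliceProjectorBlochChart

variable {d : ℕ}

/-! ## §4 Symbol algebra: the pole-free row∕column alias sums, the rank-one (projector) structure of `Aent`, and the two
«block readings of `Q′`» -/

section Symbol

variable (N : ℕ) [NeZero N]

/-- [folklore] `cphase (−u) p = cphase u (−p)`. -/
theorem cphase_neg_left (u : Fin (d + 1) → ℤ) (p : Fin (d + 1) → ℂ) : cphase (-u) p = cphase u (-p) := by
  unfold cphase; congr 1; simp only [Pi.neg_apply, Int.cast_neg]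
  exact congrArg _ (Finset.sum_congr rfl fun μ _ => by ring)

/-- [our object] the POLE-FREE ROW ALIAS SUM `Ra N a k := Σ_l e^{i k_l·a}·(qa_l·e_l)(k)` (the row factor of `S`, `= Δ^ξ(k)·Fa` off the
zero set). -/
def Ra (a : Fin (d + 1) → ℤ) (k : Fin (d + 1) → ℂ) : ℂ := ∑ l : Fin (d + 1) → Fin N, cphase a (aliasPt N l k) * (qa N l k * ew N l k)

/-- [our object] the POLE-FREE COLUMN ALIAS SUM `Rb N b k := Σ_l e^{−i k_l·b}·(qb_l·e_l)(k)`. -/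
def Rb (b : Fin (d + 1) → ℤ) (k : Fin (d + 1) → ℂ) : ℂ := ∑ l : Fin (d + 1) → Fin N, cphase (-b) (aliasPt N l k) * (qb N l k * ew N l k)

/-- [our object] **`S` IS RANK ONE**: `S N a b k = Ra N a k · Rb N b k ∕ 𝒩(k)` — everywhere (no side condition; `Aent = (qa·e)⊗(qb·e)∕𝒩`). -/
theorem S_eq_Ra_mul_Rb (a b : Fin (d + 1) → ℤ) (k : Fin (d + 1) → ℂ) : S N a b k = Ra N a k * Rb N b k / Ncal N k := by
  unfold S Ra Rb Aent
  rw [Finset.sum_mul_sum, Finset.sum_div]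
  refine Finset.sum_congr rfl fun l _ => ?_
  rw [Finset.sum_div]
  refine Finset.sum_congr rfl fun l' _ => ?_
  ring

/-- [folklore] **THE REGROUPED DENOMINATOR IS THE TRACE OF THE RANK-ONE NUMERATOR**: `𝒩(k) = Σ_l U_l(k)·e_l(k)²` (everywhere:
for `l ≠ 0` both `e_l = Δ₀∕Δ_l` and `U_l∕Δ_l²` vanish together when `Δ_l = 0`). -/
theorem Ncal_eq_sum_U_mul_ew_sq (k : Fin (d + 1) → ℂ) :
    Ncal N k = ∑ l : Fin (d + 1) → Fin N, U N l k * ew N l k ^ 2 := by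
  classical
  unfold Ncal Xne
  rw [← Finset.add_sum_erase Finset.univ _ (Finset.mem_univ (fun _ => (0 : Fin N))), ew_zero, one_pow, mul_one, Finset.mul_sum]
  congr 1
  refine Finset.sum_congr rfl fun l hl => ?_
  rw [ew_ne N (Finset.ne_of_mem_erase hl), div_pow]
  by_cases h : DeltaXi N 0 (shift N l k) = 0
  · simp [h]
  · field_simp

/-- [folklore] **THE POLE CANCELS**: `e_l(k)·Δ^ξ(k + 2πl) = Δ^ξ(k)` on the fat strip `Fat D (rOf D)` (where `Δ^ξ(· + 2πl) ≠ 0` for `l ≠ 0`). -/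
theorem ew_mul_DeltaXi_shift {k : Fin (d + 1) → ℂ} (hk : k ∈ Fat (d + 1) (rOf (d + 1))) (l : Fin (d + 1) → Fin N) :
    ew N l k * DeltaXi N 0 (shift N l k) = DeltaXi N 0 k := by
  by_cases hl : l = fun _ => 0
  · subst hl; rw [ew_zero, shift_zero, one_mul]
  · have h2 : DeltaXi N 0 (shift N l k) ≠ 0 := by
      intro h0
      have h := B4StripCauchy.norm_DeltaXi_shift_ge N 0 le_rfl (rOf_le (d + 1)) (by exact_mod_cast B4StripCauchy.d_mul_rOf_sq_le (d + 1)) hk l hl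
      rw [h0, norm_zero] at h
      linarith
    rw [ew_ne N hl, div_mul_cancel₀ _ h2]

/-- [folklore] **`Aent` IS A PROJECTOR** (on `Fat D r`, `r ≤ 1∕4`, where `qa·qb = U`): `Σ_m A_{lm}·A_{ml′} = A_{ll′}`. -/
theorem sum_Aent_mul_Aent {r : ℝ} (hr : r ≤ 1 / 4) {k : Fin (d + 1) → ℂ} (hk : k ∈ Fat (d + 1) r) (l l' : Fin (d + 1) → Fin N) :
    ∑ m : Fin (d + 1) → Fin N, Aent N l m k * Aent N m l' k = Aent N l l' k := by
  by_cases hN : Ncal N k = 0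
  · simp [Aent, hN]
  have hsum : ∑ m : Fin (d + 1) → Fin N, qb N m k * ew N m k * (qa N m k * ew N m k) = Ncal N k := by
    rw [Ncal_eq_sum_U_mul_ew_sq]
    refine Finset.sum_congr rfl fun m _ => ?_
    rw [← qa_mul_qb N hr hk m]; ring
  have h : ∑ m : Fin (d + 1) → Fin N, Aent N l m k * Aent N m l' k
      = qa N l k * ew N l k * (qb N l' k * ew N l' k) / Ncal N k ^ 2 * ∑ m, qb N m k * ew N m k * (qa N m k * ew N m k) := by
    rw [Finset.mul_sum]
    refine Finset.sum_congr rfl fun m _ => ?_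
    unfold Aent
    field_simp
  rw [h, hsum]
  unfold Aent
  field_simp

/-- [folklore] **CHARACTER ORTHOGONALITY OVER THE INTRA-BLOCK OFFSETS**: `Σ_{c ∈ {0..N−1}^D} e^{−i k_l·c}·e^{i k_{l′}·c} = N^D·δ_{ll′}`. -/
theorem sum_cphase_finSite (k : Fin (d + 1) → ℂ) (l l' : Fin (d + 1) → Fin N) :
    ∑ c : Fin (d + 1) → Fin N, cphase (-(finSite N c)) (aliasPt N l k) * cphase (finSite N c) (aliasPt N l' k)
      = if l = l' then ((N : ℂ) ^ (d + 1)) else 0 := by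
  classical
  have hpt : ∀ c : Fin (d + 1) → Fin N, cphase (-(finSite N c)) (aliasPt N l k) * cphase (finSite N c) (aliasPt N l' k)
      = ∏ μ, cexp (I * (2 * π * ((c μ : ℕ) : ℂ) / N) * ((((l' μ : ℕ) : ℤ) - ((l μ : ℕ) : ℤ) : ℤ) : ℂ)) := by
    intro c
    rw [cphase_aliasPt_eq, cphase_aliasPt_eq]
    have h0 : cexp (I * ∑ μ, k μ / N * (((-(finSite N c)) μ : ℤ) : ℂ)) * cexp (I * ∑ μ, k μ / N * ((finSite N c μ : ℤ) : ℂ)) = 1 := by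
      rw [← Complex.exp_add, ← mul_add, ← Finset.sum_add_distrib]
      conv_lhs => arg 1; arg 2; arg 2; ext μ; rw [Pi.neg_apply, Int.cast_neg, ← mul_add, neg_add_cancel, mul_zero]
      simp
    calc _ = (cexp (I * ∑ μ, k μ / N * (((-(finSite N c)) μ : ℤ) : ℂ)) * cexp (I * ∑ μ, k μ / N * ((finSite N c μ : ℤ) : ℂ)))
          * ∏ μ, (cexp (I * (2 * π * ((l μ : ℕ) : ℂ) / N) * (((-(finSite N c)) μ : ℤ) : ℂ))
            * cexp (I * (2 * π * ((l' μ : ℕ) : ℂ) / N) * ((finSite N c μ : ℤ) : ℂ))) := by rw [Finset.prod_mul_distrib]; ring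
      _ = _ := by
        rw [h0, one_mul]
        refine Finset.prod_congr rfl fun μ _ => ?_
        rw [← Complex.exp_add]
        congr 1
        simp only [finSite, Pi.neg_apply, Int.cast_neg, Int.cast_natCast, Int.cast_sub]
        ring
  simp_rw [hpt]
  rw [← Fintype.prod_sum (fun μ (t : Fin N) => cexp (I * (2 * π * ((t : ℕ) : ℂ) / N) * ((((l' μ : ℕ) : ℤ) - ((l μ : ℕ) : ℤ) : ℤ) : ℂ)))]
  simp_rw [sum_rootChar']
  have hdv : ∀ μ, ((N : ℤ) ∣ (((l' μ : ℕ) : ℤ) - ((l μ : ℕ) : ℤ))) ↔ l' μ = l μ := by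
    intro μ
    constructor
    · intro h
      have hlt : |(((l' μ : ℕ) : ℤ) - ((l μ : ℕ) : ℤ))| < N := by
        have h1 := (l' μ).isLt; have h2 := (l μ).isLt
        rw [abs_lt]; constructor <;> omega
      have h0 := Int.eq_zero_of_abs_lt_dvd h hlt
      apply Fin.ext; omega
    · intro h; rw [h, sub_self]; exact dvd_zero _
  simp_rw [hdv]
  by_cases h : l = l'
  · subst h; simp
  · rw [if_neg h]
    have : ∃ μ, l' μ ≠ l μ := by
      by_contra hc
      exact h (funext fun μ => (not_not.mp (not_exists.mp hc μ)).symm)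
    obtain ⟨μ, hμ⟩ := this
    exact Finset.prod_eq_zero (Finset.mem_univ μ) (if_neg hμ)

omit [NeZero N] in
/-- [folklore] `qa` as a character sum over the offsets: `qa N l k = N^{−D}·Σ_{c} e^{i k_l·c}`. -/
theorem qa_eq_sum_cphase (l : Fin (d + 1) → Fin N) (k : Fin (d + 1) → ℂ) :
    qa N l k = ((N : ℂ) ^ (d + 1))⁻¹ * ∑ c : Fin (d + 1) → Fin N, cphase (finSite N c) (aliasPt N l k) := by
  unfold qa gsum
  congr 1
  simp_rw [← Fin.sum_univ_eq_sum_range (fun t => cexp (I * aliasPt N l k _ * (t : ℂ)))]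
  rw [Fintype.prod_sum (fun i (t : Fin N) => cexp (I * aliasPt N l k i * ((t : ℕ) : ℂ)))]
  refine Finset.sum_congr rfl fun c _ => ?_
  unfold cphase
  rw [← Complex.exp_sum, Finset.mul_sum]
  simp only [finSite, Int.cast_natCast, mul_assoc]

omit [NeZero N] in
/-- [folklore] `qb` as a character sum over the offsets: `qb N l k = N^{−D}·Σ_{c} e^{−i k_l·c}`. -/
theorem qb_eq_sum_cphase (l : Fin (d + 1) → Fin N) (k : Fin (d + 1) → ℂ) :
    qb N l k = ((N : ℂ) ^ (d + 1))⁻¹ * ∑ c : Fin (d + 1) → Fin N, cphase (-(finSite N c)) (aliasPt N l k) := by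
  unfold qb gsum
  congr 1
  simp_rw [← Fin.sum_univ_eq_sum_range (fun t => cexp (I * -(aliasPt N l k _) * (t : ℂ)))]
  rw [Fintype.prod_sum (fun i (t : Fin N) => cexp (I * -(aliasPt N l k i) * ((t : ℕ) : ℂ)))]
  refine Finset.sum_congr rfl fun c _ => ?_
  unfold cphase
  rw [← Complex.exp_sum, Finset.mul_sum]
  simp only [finSite, Pi.neg_apply, Int.cast_neg, Int.cast_natCast]
  exact congrArg _ (Finset.sum_congr rfl fun μ _ => by ring)

/-- [folklore] divisibility of `x − c` by `N` for an offset label `c` singles out `c = locN x`. -/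
theorem dvd_sub_finSite_iff (x : Fin (d + 1) → ℤ) (c : Fin (d + 1) → Fin N) :
    (∀ μ, (N : ℤ) ∣ (x - finSite N c) μ) ↔ c = locN N x := by
  have h0 : (0 : ℤ) < N := by exact_mod_cast Nat.pos_of_ne_zero (NeZero.ne N)
  constructor
  · intro h
    funext μ
    apply Fin.ext
    have hμ := h μ
    simp only [Pi.sub_apply, finSite] at hμ
    have hc1 : ((c μ : ℕ) : ℤ) < N := by exact_mod_cast (c μ).isLt
    have hmod : x μ % N = ((c μ : ℕ) : ℤ) := by
      obtain ⟨q, hq⟩ := hμ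
      rw [show x μ = ((c μ : ℕ) : ℤ) + N * q by linarith, Int.add_mul_emod_self_left, Int.emod_eq_of_lt (by positivity) hc1]
    have : ((locN N x μ : ℕ) : ℤ) = ((c μ : ℕ) : ℤ) := by
      simp only [locN, hmod, Int.toNat_natCast]
    exact_mod_cast this.symm
  · rintro rfl μ
    refine ⟨blkN N x μ, ?_⟩
    have h := congrFun (chart_blkN_locN N x) μ
    simp only [Pi.add_apply, Pi.smul_apply, smul_eq_mul] at h
    simp only [Pi.sub_apply]
    linarith

/-- [folklore] **THE BLOCK READING OF `Q′` (column side)**: `Σ_{l} qb_l(k)·e^{i k_l·x} = e^{i k·blk(x)}` — the alias sum sees the fine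
point `x` only through its block. -/
theorem sum_qb_mul_cphase (x : Fin (d + 1) → ℤ) (k : Fin (d + 1) → ℂ) :
    ∑ l : Fin (d + 1) → Fin N, qb N l k * cphase x (aliasPt N l k) = cphase (blkN N x) k := by
  classical
  have hN : ((N : ℂ) ^ (d + 1)) ≠ 0 := pow_ne_zero _ (Nat.cast_ne_zero.mpr (NeZero.ne N))
  calc ∑ l : Fin (d + 1) → Fin N, qb N l k * cphase x (aliasPt N l k)
      = ((N : ℂ) ^ (d + 1))⁻¹ * ∑ c : Fin (d + 1) → Fin N, ∑ l : Fin (d + 1) → Fin N, cphase (x - finSite N c) (aliasPt N l k) := by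
        simp_rw [qb_eq_sum_cphase, mul_assoc, Finset.sum_mul, ← Finset.mul_sum]
        rw [Finset.sum_comm]
        congr 1
        refine Finset.sum_congr rfl fun c _ => Finset.sum_congr rfl fun l _ => ?_
        rw [sub_eq_add_neg, show cphase (x + -finSite N c) (aliasPt N l k) = cphase x (aliasPt N l k) * cphase (-finSite N c) (aliasPt N l k)
          from pw_add _ _ _, mul_comm]
    _ = ((N : ℂ) ^ (d + 1))⁻¹ * ∑ c : Fin (d + 1) → Fin N,
          (if c = locN N x then ((N : ℂ) ^ (d + 1)) * cexp (I * ∑ μ, k μ / N * (((x - finSite N c) μ : ℤ) : ℂ)) else 0) := by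
        congr 1
        refine Finset.sum_congr rfl fun c _ => ?_
        simp only [sum_cphase_aliasPt, dvd_sub_finSite_iff]
    _ = cphase (blkN N x) k := by
        rw [Finset.sum_ite_eq' Finset.univ (locN N x), if_pos (Finset.mem_univ _), ← mul_assoc, inv_mul_cancel₀ hN, one_mul]
        unfold cphase
        congr 1
        rw [Finset.mul_sum, Finset.mul_sum]
        refine Finset.sum_congr rfl fun μ _ => ?_
        have h := congrFun (chart_blkN_locN N x) μ
        simp only [Pi.add_apply, Pi.smul_apply, smul_eq_mul] at h
        have hx : (((x - finSite N (locN N x)) μ : ℤ) : ℂ) = (N : ℂ) * (blkN N x μ : ℂ) := by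
          rw [Pi.sub_apply, show x μ - finSite N (locN N x) μ = (N : ℤ) * blkN N x μ by linarith]; push_cast; ring
        have hN1 : (N : ℂ) ≠ 0 := Nat.cast_ne_zero.mpr (NeZero.ne N)
        rw [hx]
        field_simp

/-- [folklore] **THE BLOCK READING OF `Q′` (row side)**: `Σ_{l} qa_l(k)·e^{−i k_l·y} = e^{−i k·blk(y)}`. -/
theorem sum_qa_mul_cphase_neg (y : Fin (d + 1) → ℤ) (k : Fin (d + 1) → ℂ) :
    ∑ l : Fin (d + 1) → Fin N, qa N l k * cphase (-y) (aliasPt N l k) = cphase (-(blkN N y)) k := by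
  classical
  have hN : ((N : ℂ) ^ (d + 1)) ≠ 0 := pow_ne_zero _ (Nat.cast_ne_zero.mpr (NeZero.ne N))
  calc ∑ l : Fin (d + 1) → Fin N, qa N l k * cphase (-y) (aliasPt N l k)
      = ((N : ℂ) ^ (d + 1))⁻¹ * ∑ c : Fin (d + 1) → Fin N, ∑ l : Fin (d + 1) → Fin N, cphase (-(y - finSite N c)) (aliasPt N l k) := by
        simp_rw [qa_eq_sum_cphase, mul_assoc, Finset.sum_mul, ← Finset.mul_sum]
        rw [Finset.sum_comm]
        congr 1
        refine Finset.sum_congr rfl fun c _ => Finset.sum_congr rfl fun l _ => ?_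
        rw [neg_sub, sub_eq_add_neg, show cphase (finSite N c + -y) (aliasPt N l k) = cphase (finSite N c) (aliasPt N l k) * cphase (-y) (aliasPt N l k)
          from pw_add _ _ _]
    _ = ((N : ℂ) ^ (d + 1))⁻¹ * ∑ c : Fin (d + 1) → Fin N,
          (if c = locN N y then ((N : ℂ) ^ (d + 1)) * cexp (I * ∑ μ, k μ / N * (((-(y - finSite N c)) μ : ℤ) : ℂ)) else 0) := by
        congr 1
        refine Finset.sum_congr rfl fun c _ => ?_
        rw [sum_cphase_aliasPt]
        have hiff : (∀ μ, (N : ℤ) ∣ (-(y - finSite N c)) μ) ↔ c = locN N y := by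
          rw [← dvd_sub_finSite_iff N y c]
          exact forall_congr' fun μ => by rw [Pi.neg_apply, dvd_neg]
        simp only [hiff]
    _ = cphase (-(blkN N y)) k := by
        rw [Finset.sum_ite_eq' Finset.univ (locN N y), if_pos (Finset.mem_univ _), ← mul_assoc, inv_mul_cancel₀ hN, one_mul]
        unfold cphase
        congr 1
        rw [Finset.mul_sum, Finset.mul_sum]
        refine Finset.sum_congr rfl fun μ _ => ?_
        have h := congrFun (chart_blkN_locN N y) μ
        simp only [Pi.add_apply, Pi.smul_apply, smul_eq_mul] at h
        have hy : (((-(y - finSite N (locN N y))) μ : ℤ) : ℂ) = -((N : ℂ) * (blkN N y μ : ℂ)) := by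
          rw [Pi.neg_apply, Pi.sub_apply, show y μ - finSite N (locN N y) μ = (N : ℤ) * blkN N y μ by linarith]; push_cast; ring
        have hN1 : (N : ℂ) ≠ 0 := Nat.cast_ne_zero.mpr (NeZero.ne N)
        rw [hy, Pi.neg_apply, Int.cast_neg]
        field_simp

end Symbol

end Summit.QuantumFields.BalabanUV.Beta.FP.SliceProjectorBloch

end
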